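import Mathlib
import Literature.Analysis.Calculus.PoincareLemmaOneFormStarConvex
import Summits.AnomalousDissipation.AnomalousDissipation.Theorems.DyadicWallCascadeHalfSpaceHierarchyCurlOfDegreeZeroField
import Summits.AnomalousDissipation.AnomalousDissipation.Theorems.HalfSpaceHierarchy.Negative.Analytic

/-!
# Stub `stub_xIndepStreamFunction` of the line `Sketch`
# (crux `DyadicWallCascade.HalfSpaceHierarchy`, stmt-AnomalousDissipation-18627)

Sorry-free discharge of the registered tool stub `stub_xIndepStreamFunction` of the lead's skeleton
(`Cruxes/HalfSpaceHierarchy/Lines/Sketch.lean`, cycle c1): the first step of the `2½`-D no-go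
"no witness of `HalfSpaceHierarchy` is independent of `x`".

**Statement.**  Let `V : ℝ³ → ℝ³` be smooth on the open upper half-space `H = {X | 0 < X 2}`
(coordinates `X 0 = x`, `X 1 = y`, `X 2 = z`), independent of `x` there
(`V (X + t e₀) = V X`) and divergence free there (`∑ i, (DV(X) eᵢ)ᵢ = 0`).  Then the planar
field `(V₁, V₂)` has a smooth *stream function* on `H`: there is `ψ : ℝ³ → ℝ`, smooth on `H`, with
`dψ(X) = V₁(X) dz − V₂(X) dy`, i.e. `Dψ(X) = V₁(X) • proj 2 − V₂(X) • proj 1`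
(so `∂_y ψ = −V₂`, `∂_z ψ = V₁`, `∂_x ψ = 0`).

**Proof.**  The Poincaré lemma for `1`-forms on open star-shaped sets
(`Literature.Analysis.Calculus.exists_contDiffOn_hasFDerivAt_of_fderiv_symm_of_starConvex`,
Spivak, *Calculus on Manifolds*, Thm. 4-11) applied to the smooth `1`-form
`A(X) = V₁(X) dz − V₂(X) dy` on the convex open set `H`.  Its closedness is the symmetry of
`DA(X)(v)(w) = (DV(X) v)₁ w₂ − (DV(X) v)₂ w₁` in `(v, w)`; writing `aᵢⱼ = (DV(X) eⱼ)ᵢ`,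
`x`-independence gives `DV(X) e₀ = 0` (the curve `t ↦ V (X + t e₀)` is constant), the
divergence clause then reads `a₁₁ + a₂₂ = 0`, and expanding `v, w` along `e₁, e₂` the defect of
symmetry is `(a₁₁ + a₂₂)(v₁ w₂ − v₂ w₁) = 0`.

Source: folklore (stream function of a planar incompressible flow); Spivak 1965, Thm. 4-11 for
the Poincaré lemma (proved in the tree).  Reused from the tree: `isOpen_halfSpace_coord_two_pos`
(`…CurlOfDegreeZeroField`) and `HalfSpaceHierarchyNegative.convex_halfSpace` (`Negative/Analytic`).
-/

set_option linter.dupNamespace false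

noncomputable section

open scoped Topology ContDiff

namespace Summit.AnomalousDissipation.AnomalousDissipation.Theorems.HalfSpaceHierarchy

/-- The open upper half-space `{X | 0 < X 2}` of `ℝ³` is star-shaped with respect to
`e₂ = (0, 0, 1)`, which lies in it: it is convex (`HalfSpaceHierarchyNegative.convex_halfSpace`,
an open half-space of the linear functional `X ↦ X 2`). [folklore] -/
theorem xIndepSF_starConvex_halfSpace :
    StarConvex ℝ (EuclideanSpace.single (2 : Fin 3) (1 : ℝ))
      {X : EuclideanSpace ℝ (Fin 3) | 0 < X 2} :=
  HalfSpaceHierarchyNegative.convex_halfSpace.starConvex (by simp)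

/-- **`∂ₓ V = 0` for an `x`-independent field.**  If `V` is differentiable at `X` and
`V (X + t e₀) = V X` for all `t`, then `DV(X) e₀ = 0`: the curve `t ↦ V (X + t e₀)` is
constant, and by the chain rule its derivative at `t = 0` is `DV(X) e₀`. [folklore] -/
theorem xIndepSF_fderiv_single_zero
    (V : EuclideanSpace ℝ (Fin 3) → EuclideanSpace ℝ (Fin 3)) {X : EuclideanSpace ℝ (Fin 3)}
    (hd : DifferentiableAt ℝ V X)
    (hx : ∀ t : ℝ, V (X + t • EuclideanSpace.single 0 (1 : ℝ)) = V X) :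
    fderiv ℝ V X (EuclideanSpace.single 0 (1 : ℝ)) = 0 := by
  set e₀ : EuclideanSpace ℝ (Fin 3) := EuclideanSpace.single 0 (1 : ℝ) with he₀
  -- the affine curve through `X` in the direction `e₀`
  have hc : HasDerivAt (fun t : ℝ => X + t • e₀) e₀ 0 := by
    simpa using ((hasDerivAt_id (0 : ℝ)).smul_const e₀).const_add X
  have hcomp : HasDerivAt (V ∘ fun t : ℝ => X + t • e₀) (fderiv ℝ V X e₀) 0 :=
    hd.hasFDerivAt.comp_hasDerivAt_of_eq (0 : ℝ) hc (by simp)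
  have hconst : (V ∘ fun t : ℝ => X + t • e₀) = fun _ => V X := funext fun t => hx t
  rw [hconst] at hcomp
  exact hcomp.unique (hasDerivAt_const 0 (V X))

/-- **Smoothness of the `1`-form `A(X) = V₁(X) dz − V₂(X) dy`.**  If `V` is `C^∞` on the
half-space then so is `X ↦ V₁(X) • proj 2 − V₂(X) • proj 1` (coordinates of a `C^∞` map are
`C^∞`, and `c ↦ c • L` is linear). [folklore] -/
theorem xIndepSF_contDiffOn_form
    (V : EuclideanSpace ℝ (Fin 3) → EuclideanSpace ℝ (Fin 3))
    (hV : ContDiffOn ℝ ∞ V {X : EuclideanSpace ℝ (Fin 3) | 0 < X 2}) :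
    ContDiffOn ℝ ∞ (fun X : EuclideanSpace ℝ (Fin 3) =>
        (V X 1) • (EuclideanSpace.proj (2 : Fin 3) : EuclideanSpace ℝ (Fin 3) →L[ℝ] ℝ)
          - (V X 2) • (EuclideanSpace.proj (1 : Fin 3) : EuclideanSpace ℝ (Fin 3) →L[ℝ] ℝ))
      {X : EuclideanSpace ℝ (Fin 3) | 0 < X 2} :=
  ((contDiffOn_euclidean.1 hV 1).smul_const
      (EuclideanSpace.proj (2 : Fin 3) : EuclideanSpace ℝ (Fin 3) →L[ℝ] ℝ)).sub
    ((contDiffOn_euclidean.1 hV 2).smul_const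
      (EuclideanSpace.proj (1 : Fin 3) : EuclideanSpace ℝ (Fin 3) →L[ℝ] ℝ))

/-- **Derivative of the `1`-form `A(X) = V₁(X) dz − V₂(X) dy`.**  If `V` is differentiable at
`X`, then `DA(X)(v)(w) = (DV(X) v)₁ w₂ − (DV(X) v)₂ w₁` (product rule with the constant
covectors `dz = proj 2`, `dy = proj 1`). [folklore] -/
theorem xIndepSF_fderiv_form_apply
    (V : EuclideanSpace ℝ (Fin 3) → EuclideanSpace ℝ (Fin 3)) {X : EuclideanSpace ℝ (Fin 3)}
    (hd : DifferentiableAt ℝ V X) (v w : EuclideanSpace ℝ (Fin 3)) :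
    fderiv ℝ (fun Y : EuclideanSpace ℝ (Fin 3) =>
        (V Y 1) • (EuclideanSpace.proj (2 : Fin 3) : EuclideanSpace ℝ (Fin 3) →L[ℝ] ℝ)
          - (V Y 2) • (EuclideanSpace.proj (1 : Fin 3) : EuclideanSpace ℝ (Fin 3) →L[ℝ] ℝ)) X v w
      = (fderiv ℝ V X v) 1 * w 2 - (fderiv ℝ V X v) 2 * w 1 := by
  have hVX : HasFDerivAt V (fderiv ℝ V X) X := hd.hasFDerivAt
  -- the coordinate functions `Y ↦ V Y 1`, `Y ↦ V Y 2`
  have h1 : HasFDerivAt (fun Y : EuclideanSpace ℝ (Fin 3) => V Y 1)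
      ((EuclideanSpace.proj (1 : Fin 3) : EuclideanSpace ℝ (Fin 3) →L[ℝ] ℝ).comp
        (fderiv ℝ V X)) X :=
    (EuclideanSpace.proj (1 : Fin 3) : EuclideanSpace ℝ (Fin 3) →L[ℝ] ℝ).hasFDerivAt.comp X hVX
  have h2 : HasFDerivAt (fun Y : EuclideanSpace ℝ (Fin 3) => V Y 2)
      ((EuclideanSpace.proj (2 : Fin 3) : EuclideanSpace ℝ (Fin 3) →L[ℝ] ℝ).comp
        (fderiv ℝ V X)) X :=
    (EuclideanSpace.proj (2 : Fin 3) : EuclideanSpace ℝ (Fin 3) →L[ℝ] ℝ).hasFDerivAt.comp X hVX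
  -- product rule for `c ↦ c • L` and the difference
  have hA : HasFDerivAt (fun Y : EuclideanSpace ℝ (Fin 3) =>
      (V Y 1) • (EuclideanSpace.proj (2 : Fin 3) : EuclideanSpace ℝ (Fin 3) →L[ℝ] ℝ)
        - (V Y 2) • (EuclideanSpace.proj (1 : Fin 3) : EuclideanSpace ℝ (Fin 3) →L[ℝ] ℝ))
      ((((EuclideanSpace.proj (1 : Fin 3) : EuclideanSpace ℝ (Fin 3) →L[ℝ] ℝ).comp
          (fderiv ℝ V X)).smulRight
          (EuclideanSpace.proj (2 : Fin 3) : EuclideanSpace ℝ (Fin 3) →L[ℝ] ℝ))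
        - (((EuclideanSpace.proj (2 : Fin 3) : EuclideanSpace ℝ (Fin 3) →L[ℝ] ℝ).comp
          (fderiv ℝ V X)).smulRight
          (EuclideanSpace.proj (1 : Fin 3) : EuclideanSpace ℝ (Fin 3) →L[ℝ] ℝ))) X :=
    (h1.smul_const (EuclideanSpace.proj (2 : Fin 3) : EuclideanSpace ℝ (Fin 3) →L[ℝ] ℝ)).sub
      (h2.smul_const (EuclideanSpace.proj (1 : Fin 3) : EuclideanSpace ℝ (Fin 3) →L[ℝ] ℝ))
  rw [hA.fderiv]
  simp [ContinuousLinearMap.smulRight_apply, ContinuousLinearMap.comp_apply]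

/-- **Closedness of `V₁ dz − V₂ dy`.**  For a linear map `D : ℝ³ → ℝ³` with `D e₀ = 0` and
`∑ i, (D eᵢ)ᵢ = 0`, the bilinear form `(v, w) ↦ (D v)₁ w₂ − (D v)₂ w₁` is symmetric: expanding
`v, w` along `e₁, e₂` (the `e₀`-components drop out), the defect of symmetry is
`(a₁₁ + a₂₂)(v₁ w₂ − v₂ w₁)` with `aᵢⱼ = (D eⱼ)ᵢ`, and `a₁₁ + a₂₂ = 0`. [folklore] -/
theorem xIndepSF_symm
    (D : EuclideanSpace ℝ (Fin 3) →L[ℝ] EuclideanSpace ℝ (Fin 3))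
    (h0 : D (EuclideanSpace.single 0 (1 : ℝ)) = 0)
    (htr : ∑ i : Fin 3, (D (EuclideanSpace.single i (1 : ℝ))) i = 0)
    (v w : EuclideanSpace ℝ (Fin 3)) :
    (D v) 1 * w 2 - (D v) 2 * w 1 = (D w) 1 * v 2 - (D w) 2 * v 1 := by
  -- expansion along the standard basis, the `e₀`-component dropping out
  have hexp : ∀ u : EuclideanSpace ℝ (Fin 3),
      D u = u 1 • D (EuclideanSpace.single 1 (1 : ℝ))
        + u 2 • D (EuclideanSpace.single 2 (1 : ℝ)) := by
    intro u
    have hu : u = u 0 • EuclideanSpace.single 0 (1 : ℝ) + u 1 • EuclideanSpace.single 1 (1 : ℝ)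
        + u 2 • EuclideanSpace.single 2 (1 : ℝ) := by
      ext i
      fin_cases i <;> simp
    conv_lhs => rw [hu]
    rw [map_add, map_add, map_smul, map_smul, map_smul, h0, smul_zero, zero_add]
  -- the trace condition without the vanishing `e₀`-term
  have htr' :
      (D (EuclideanSpace.single 1 (1 : ℝ))) 1 + (D (EuclideanSpace.single 2 (1 : ℝ))) 2 = 0 := by
    rw [Fin.sum_univ_three, h0] at htr
    simpa using htr
  rw [hexp v, hexp w]
  simp only [PiLp.add_apply, PiLp.smul_apply, smul_eq_mul]
  linear_combination (v 1 * w 2 - v 2 * w 1) * htr'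

/-- **Tool stub `stub_xIndepStreamFunction`** (line `Sketch`, cycle c1; `2½`-D no-go, step 1).
Stream function of an `x`-independent divergence-free smooth field on the open half-space
`H = {0 < X 2}`: there is `ψ`, smooth on `H`, with `dψ = V₁ dz − V₂ dy` there (so `∂_y ψ = −V₂`,
`∂_z ψ = V₁`, `∂_x ψ = 0`).  Poincaré lemma
(`Literature.Analysis.Calculus.exists_contDiffOn_hasFDerivAt_of_fderiv_symm_of_starConvex`,
Spivak 1965, Thm. 4-11) for the closed `1`-form `X ↦ V₁(X) dz − V₂(X) dy` on the convex open set
`H`; closedness is `∂_y V₁ + ∂_z V₂ = 0`, i.e. the divergence clause minus `∂_x V₀ = 0`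
(`xIndepSF_symm`, `xIndepSF_fderiv_single_zero`). [folklore] -/
theorem stub_xIndepStreamFunction :
    ∀ (V : EuclideanSpace ℝ (Fin 3) → EuclideanSpace ℝ (Fin 3)),
      ContDiffOn ℝ ((⊤ : ℕ∞) : WithTop ℕ∞) V {X : EuclideanSpace ℝ (Fin 3) | 0 < X 2} →
      (∀ X : EuclideanSpace ℝ (Fin 3), 0 < X 2 → ∀ t : ℝ, V (X + t • EuclideanSpace.single 0 (1 : ℝ)) = V X) →
      (∀ X : EuclideanSpace ℝ (Fin 3), 0 < X 2 →
        ∑ i : Fin 3, (fderiv ℝ V X (EuclideanSpace.single i (1 : ℝ))) i = 0) →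
      ∃ ψ : EuclideanSpace ℝ (Fin 3) → ℝ,
        ContDiffOn ℝ ((⊤ : ℕ∞) : WithTop ℕ∞) ψ {X : EuclideanSpace ℝ (Fin 3) | 0 < X 2} ∧
        ∀ X : EuclideanSpace ℝ (Fin 3), 0 < X 2 →
          HasFDerivAt ψ ((V X 1) • (EuclideanSpace.proj (2 : Fin 3) : EuclideanSpace ℝ (Fin 3) →L[ℝ] ℝ)
            - (V X 2) • (EuclideanSpace.proj (1 : Fin 3) : EuclideanSpace ℝ (Fin 3) →L[ℝ] ℝ)) X := by
  intro V hV hx hdiv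
  have hH : IsOpen {X : EuclideanSpace ℝ (Fin 3) | 0 < X 2} := isOpen_halfSpace_coord_two_pos
  -- `V` is differentiable at the points of the open set `H`
  have hdiff : ∀ X : EuclideanSpace ℝ (Fin 3), 0 < X 2 → DifferentiableAt ℝ V X := fun X hX =>
    ((hV.differentiableOn (by simp)) X hX).differentiableAt (hH.mem_nhds hX)
  -- the Poincaré lemma for the closed smooth `1`-form `V₁ dz − V₂ dy` on the convex open `H`
  obtain ⟨ψ, hψ, hdψ⟩ :=
    Literature.Analysis.Calculus.exists_contDiffOn_hasFDerivAt_of_fderiv_symm_of_starConvex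
      (A := fun X : EuclideanSpace ℝ (Fin 3) =>
        (V X 1) • (EuclideanSpace.proj (2 : Fin 3) : EuclideanSpace ℝ (Fin 3) →L[ℝ] ℝ)
          - (V X 2) • (EuclideanSpace.proj (1 : Fin 3) : EuclideanSpace ℝ (Fin 3) →L[ℝ] ℝ))
      hH xIndepSF_starConvex_halfSpace (xIndepSF_contDiffOn_form V hV) (fun X hX v w => by
        rw [xIndepSF_fderiv_form_apply V (hdiff X hX), xIndepSF_fderiv_form_apply V (hdiff X hX)]
        exact xIndepSF_symm (fderiv ℝ V X)
          (xIndepSF_fderiv_single_zero V (hdiff X hX) (hx X hX)) (hdiv X hX) v w)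
  exact ⟨ψ, hψ, fun X hX => hdψ X hX⟩

end Summit.AnomalousDissipation.AnomalousDissipation.Theorems.HalfSpaceHierarchy

end
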